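import Summits.QuantumFields.YangMills.Theorems.BalabanUVNodesN11SameWitnessZhPinOfSolvable
import Summits.QuantumFields.YangMills.Theorems.BalabanUVNodesN11CubeCoverRowOfNesting
import Literature.MathematicalPhysics.QuantumFieldTheory.Balaban1983to89.Node00.Record13NumericsOfThm1CCMW

/-!
# DAG node N11 — (γ′) THE SAME-WITNESS NO-EXPANSION 𝐓-STEP IN THE ZhPin CLASS WITH THE CUBE-COVER ROW DISCHARGED (`hcov` ↦ the nesting numeric `L·M₂ ∣ M`) AND THE FOUR
# REDUNDANT STRUCTURAL BINDERS DROPPED (`1 ≤ M`, `k+1 ≤ m+K`, the level-`k` window and `PartCompat₁₃ … k` — all implied by the face's other rows); conclusion VERBATIM p605244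

HEADER — WORK-UNIT METADATA.  Cell `pub-ymgap`, YM-PLAN Track A (HUMAN RULING D-0062 ∕ D-0149 width seats), seat `pub-ymgap-dag-n11-w4` (g3; WIDTH SEAT 4 of 4 on
NODE n11 [B14]), route `BalabanUVNodes`, item K1⁷ `StabilityBAtRecordR13SepCoPH` = stmt-QuantumFields-20542 (helper, `--kind proof --supports 20542 --as helper`, count-neutral).
[III] = [Balaban1988Convergent].  Over dag-n11-d g13's `…N11SameWitnessZhPinOfSolvable` (p605244, ★★★★★ (γ′) — the consumer-facing endpoint of the `SupplierBorel` road, read by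
dag-n11-w1 g2's re-key of THEOREM 1 along the witness chain) and this seat's `…N11CubeCoverRowOfNesting` (★★ `cover_row_of_partCompat_of_nesting`: the cube-cover row from
`PartCompat₁₃` and `L·M₂ ∣ M`).

WHY THIS FILE.  p605244 displays, per level `1 ≤ j ≤ k+1`, K0's per-cube [15]-solvability, the CUBE COVER `hcov` and the numerics, plus the structural rows.  Five of its binders are
implied by the others: `hcov` (⟸ `PartCompat₁₃ … (k+1)` ∧ `L·M₂ ∣ M`, this seat's row), `1 ≤ M` (⟸ `0 < M₁ ≤ M`), `k + 1 ≤ m + K` (⟸ `k < K`, as `(F.P p.K).K = p.K`), the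
level-`k` window `InInterval θ.γ k` (⟸ the level-`(k+1)` window) and `PartCompat₁₃ … k` (⟸ `PartCompat₁₃ … (k+1)`, `PartCompat₁₃.of_le`).  THIS FILE states (γ′) without them:
after it, the same-witness clause in the ZhPin class asks exactly `Provisos₁₃SepCoPH`, `Admissible`, `s2.Pos`, `0 < M₁ ≤ M`, `k < K`, `1 ≤ k`, the level-`(k+1)` window and
`PartCompat₁₃`, `2 ≤ cR`, `L·M₂ ∣ M`, the five numeric rows (dag-n11-w3 g3's scalars supply them BY NAME: `…N11NoExpansionNumerics.h3_of_scalars` etc.), K0's solvability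
`hsolv`, and the named §2 witness with Borel 𝐁-terms.

WHAT THIS FILE PROVES (0 `sorry`, 0 `def`).  §1 ★★★★★ `clause_succ_sameWitness_of_hasSect2FormAtZS_of_borelB_of_zhPin_of_solvable_of_nesting` — p605244's (γ′) with `hcov`,
`hM`, `hkm`, `hw`, `hPC` REPLACED by `(hdiv : L * M₂ ∣ M)` and derivations from `hM₁ hle hk hw' hPC'`; one-line composition; conclusion VERBATIM.  §2 (A6, the new binder is
INHABITED at K1's witness of record): `nesting_theta13OfThm1CCMW` — at dag-n21-c's `θ₁₅ᶜᶜᴹᵂ(j; γ)` (`M₂ = 1`, `M = L^j`, both `rfl`) the nesting numeric `L·M₂ ∣ M` holds for every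
`j ≥ 1` (`L ∣ L^j`); `nesting_theta13OfThm1CCM` (the `γ = ½` member).

HONEST FRAMING.  Helper lane of K1⁷; composition + ℕ bookkeeping; nothing of [III] asserted (solvability, numerics, `Provisos₁₃SepCoPH`, the nesting numeric are HYPOTHESES).
N11 NOT discharged; K1⁷ NOT closed; counts unmoved (typed 28∕28 · discharged 5∕27).  One finite four-torus programme at fixed `ε = L^{−K}` — NOT ℝ⁴, NOT OS, NOT a mass gap,
NOT Clay.  No `sorry`, `axiom`, `def`, `instance`, `notation`.  Sources (SHAPE only): [III] Theorem p.245, (2.1)–(2.2) pp.254–255, (2.5) p.255, (2.17)–(2.18) p.257, (2.20)–(2.28)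
pp.258–259, (3.16) p.268, (3.24)–(3.25) p.270.
-/

noncomputable section

open MeasureTheory
open scoped BigOperators ENNReal NNReal Matrix.Norms.L2Operator

namespace Summit.QuantumFields.YangMills.Theorems.BalabanUVNodesN11SameWitnessZhPinOfSolvableOfNesting

open Literature.MathematicalPhysics.QuantumFieldTheory.Balaban1983to89 T4Continuum T4NestedCovariance Node00 Node00.Tk DagBinding
open B15DeterminingSets B8Eq17ClassAkV1 B14.Eq218Concrete B10Eq42TorusConstraint
open B14.Eq213MaximalDomains (side)
open B14.Eq213DetSet (Bj)
open Literature.MathematicalPhysics.QuantumFieldTheory.BalabanImbrieJaffe1984to88.BIJ85Eq453GaugeField (qsstarGIter0)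
open BalabanUVNodesN11FluctTruncationDefs (IsFluctLocal)
open BalabanUVNodesN11SpaceTruncationDefs BalabanUVNodesN11SpaceTruncationBorelBDefs
open BalabanUVNodesN11HistoryPinnedResidualDefs BalabanUVNodesN11RePinnedParamDefs
open BalabanUVNodesN11SameWitnessZhPinOfSolvable (clause_succ_sameWitness_of_hasSect2FormAtZS_of_borelB_of_zhPin_of_solvable)
open BalabanUVNodesN11CubeCoverRowOfNesting (cover_row_of_partCompat_of_nesting)

variable {F : T4Family} {N : ℕ} [NeZero N]

variable (θ : Stage13HParams F N) (p : B12.RunParams)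

/-! ## §1  (γ′) with the cube cover discharged and the redundant structural binders dropped -/

/-- **★★★★★ (γ′) THE SAME-WITNESS NO-EXPANSION 𝐓-STEP CLAUSE IN THE ZhPin CLASS — CUBE COVER DISCHARGED, REDUNDANT STRUCTURAL BINDERS DROPPED**: p605244's face with
`hcov` ↦ `L·M₂ ∣ M` (via `PartCompat₁₃ … (k+1)`), and `1 ≤ M`, `k+1 ≤ m+K`, the level-`k` window, `PartCompat₁₃ … k` derived from `0 < M₁ ≤ M`, `k < K`, the level-`(k+1)`
window and `PartCompat₁₃ … (k+1)`; conclusion VERBATIM (the clause for the GIVEN witness `(t₀ (init s′), E₀ (init s′))` at every no-expansion child).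
[cite: Balaban1988Convergent, Theorem p.245, Thm 1 p.262, (2.1)–(2.2) pp.254–255, (2.5) p.255, (2.7) p.255, (2.10) p.256, (2.16)–(2.18) p.257, (2.20)–(2.28) pp.258–259, (2.41)–(2.42) p.261, (3.5) p.265, (3.16) p.268, (3.24)–(3.25) p.270; Balaban1985Variational, Thm 1 (7)–(8) pp.278–279; Balaban1985Averaging, Prop. 2 p.26; Balaban1985RegularSpaces, (1.3)–(1.6) p.77; Balaban1989LargeFieldI, (0.2)–(0.3) p.176] -/
theorem clause_succ_sameWitness_of_hasSect2FormAtZS_of_borelB_of_zhPin_of_solvable_of_nesting (hζ0 : ∀ (p' : B12.RunParams) (n : ℕ) (Ω Λ : ℕ → Set (Site (F.P p'.K) 0)), (θ.Zh p' n Ω Λ).ζ0 = (ZhPinOfRecord₁₃ θ.toStage13Params p' Ω Λ).ζ0)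
    (h : θ.Provisos₁₃SepCoPH F N) (hθ : θ.Admissible F N)
    (hpos : θ.s2.Pos) (hM₁ : 0 < θ.ν.M₁) (hle : θ.ν.M₁ ≤ θ.τ9.M) {k : ℕ} (hk : k < p.K)
    (hw' : Step.InInterval θ.γ (k + 1) (gOfRecord₁₃ F N θ.toStage13Params p)) (hPC' : PartCompat₁₃ F N θ.toStage13Params p (k + 1))
    (hk1 : 1 ≤ k) (hcR : 2 ≤ θ.s2.cR) (hdiv : (F.P p.K).L * θ.ν.M₂ ∣ θ.τ9.M)
    (h3 : ∀ j, 1 ≤ j → j ≤ k + 1 →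
      3 * side (F.P p.K).L θ.ν.M₁ j ≤ cubeSide (F.P p.K).L θ.ν.M₂ (RkOfRecord (F.P p.K).L θ.ν.r (gOfRecord₁₃ F N θ.toStage13Params p j)) j)
    (hR : ∀ j, 1 ≤ j → j ≤ k + 1 → (F.P p.K).L ^ j + (((F.P p.K).d + 4) * (F.P p.K).L + 2) * (∑ l ∈ Finset.range j, (F.P p.K).L ^ l) + 2 ≤
      cubeSide (F.P p.K).L θ.ν.M₂ (RkOfRecord (F.P p.K).L θ.ν.r (gOfRecord₁₃ F N θ.toStage13Params p j)) j)
    (hε : ∀ j, 1 ≤ j → j ≤ k + 1 → 0 < epsOfRecord θ.ν (gOfRecord₁₃ F N θ.toStage13Params p) j)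
    (hε3 : ∀ j, 1 ≤ j → j ≤ k + 1 → (143 * (((((F.P p.K).d + 4 : ℕ) : ℝ)) ^ 2 / 4) ^ 2) * epsOfRecord θ.ν (gOfRecord₁₃ F N θ.toStage13Params p) j ≤ 1 / 3)
    (hε2 : ∀ j, 1 ≤ j → j ≤ k + 1 →
      2 * epsOfRecord θ.ν (gOfRecord₁₃ F N θ.toStage13Params p) j ≤ 2 * ExpMeanLog.deltaSU (Fin N) / ((((F.P p.K).d + 4) * (F.P p.K).L : ℕ) : ℝ) ^ 2)
    (hsolv : ∀ j, 1 ≤ j → j ≤ k + 1 → ∀ (s : SeqOfRecord F θ.ν θ.τ9.M (gOfRecord₁₃ F N θ.toStage13Params p) p.K j) (V : GaugeField (F.P p.K) j (SU N)),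
      chiSeqOfRecord F N θ.ν θ.τ9.M (gOfRecord₁₃ F N θ.toStage13Params p) p.K j s V ≠ 0 →
      ∀ a ∈ cubesIn (fun a : ↥(cubeIndices (F.P p.K) (cubeSide (F.P p.K).L θ.ν.M₂ (RkOfRecord (F.P p.K).L θ.ν.r (gOfRecord₁₃ F N θ.toStage13Params p j)) j)) =>
          cubeEnl (F.P p.K) (cubeSide (F.P p.K).L θ.ν.M₂ (RkOfRecord (F.P p.K).L θ.ν.r (gOfRecord₁₃ F N θ.toStage13Params p j)) j) a 0) (s.Ω j),
        ∃ U₀, IsMinimizer (avOfRecord F N p.K) {U | PlaqSmall (θ.ν.εreg * (F.P p.K).eta j ^ 2) U}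
          (Bj θ.ν.M₁ (cubeEnl (F.P p.K) (cubeSide (F.P p.K).L θ.ν.M₂ (RkOfRecord (F.P p.K).L θ.ν.r (gOfRecord₁₃ F N θ.toStage13Params p j)) j) a 4) j)
          (avgFamily (avOfRecord F N p.K) (qsstarGIter0 j V)) U₀)
    (t₀ : SeqOfRecord F θ.ν θ.τ9.M (gOfRecord₁₃ F N θ.toStage13Params p) p.K k → Sect2.TermValues (F.P p.K) (MatA N) (FluctV N) θ.τ9.M)
    (E₀ : SeqOfRecord F θ.ν θ.τ9.M (gOfRecord₁₃ F N θ.toStage13Params p) p.K k → ℝ)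
    (hform₀ : HasSect2FormAtZS F N (FluctV N) p.K (settingOfRecord₁₃ F N θ.toStage13Params p) k (θ.rzAt p) (WtOfRecord₁₃H F N θ p)
      (UbgOfRecord₁₃CoP F N θ.toStage13Params p k)
      (fun s₀ t' => Sect2.LawsRT (sect2TowerOfRecord F N (FluctV N) p.K (settingOfRecord₁₃ F N θ.toStage13Params p) (θ.rzAt p s₀) s₀ t')
        (settingOfRecord₁₃ F N θ.toStage13Params p).lf k)
      (slotsOfRecord F N θ.ν θ.τ9 (EOfRecord₁₃ F N θ.toStage13Params) (wOfRecord₉ F N θ.toStage9Params) θ.ppSel p (gOfRecord₁₃ F N θ.toStage13Params p) k) t₀ E₀)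
    (hBt : ∀ s₀ (S' : ℕ → Set (Site (F.P p.K) 0)) (j : ℕ) (X : (Sect2.domSys (F.P p.K) θ.τ9.M j).Dom), 1 ≤ j → j ≤ k →
      Measurable (fun q : GaugeField (F.P p.K) 0 (SU N) × MSFluct (F.P p.K) (FluctV N) =>
        (t₀ s₀).B j X (Sect2.ofBackgroundC (settingOfRecord₁₃ F N θ.toStage13Params p).ι q.1) (S', q.2)))
    :
    ∀ (s : SeqOfRecord F θ.ν θ.τ9.M (gOfRecord₁₃ F N θ.toStage13Params p) p.K (k + 1)), s.Ω (k + 1) = ∅ →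
        -- (P) prefix agreement below `k`
        (∀ j, j < k → (θ.zhAt p s).ζ0 j = (θ.zhAt p s.init).ζ0 j ∧ (θ.zhAt p s).quad j = (θ.zhAt p s.init).quad j) →
        -- (V) the generation-`k` pin with the old front factor
        (∀ (V' : GaugeField (F.P p.K) (k + 1) (SU N)) (U₀ : GaugeField (F.P p.K) k (SU N)),
          (θ.zhAt p s).ζ0 k Set.univ (pairCfgAt (V := FluctV N) k V' U₀) =
            chiSeqOfRecord F N θ.ν θ.τ9.M (gOfRecord₁₃ F N θ.toStage13Params p) p.K k s.init U₀ *
              wOfRecord₉ F N θ.toStage9Params p (gOfRecord₁₃ F N θ.toStage13Params p) k s U₀ ((avOfRecord F N p.K k).avg U₀)) →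
        -- `quad_k(∅) = 0` on the two-scale configurations
        (∀ (V' : GaugeField (F.P p.K) (k + 1) (SU N)) (U₀ : GaugeField (F.P p.K) k (SU N)), (θ.zhAt p s).quad k ∅ (pairCfgAt (V := FluctV N) k V' U₀) = 0) →
        -- `k`-locality of `quad_j(Λ_{j+1})`, `j < k`
        (∀ j, j < k → ∀ ω ω' : MultiCfg (F.P p.K) (SU N) (FluctV N), (∀ i, i ≤ k → ω i = ω' i) →
          (θ.zhAt p s).quad j (s.init.Λ (j + 1)) ω = (θ.zhAt p s).quad j (s.init.Λ (j + 1)) ω') →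
        -- measurability of the residual serving `s′`
        (∀ j (Y : Set (Site (F.P p.K) 0)), Measurable ((θ.zhAt p s).ζ0 j Y)) →
        (∀ j (Λ' : Set (Site (F.P p.K) 0)), Measurable ((θ.zhAt p s).quad j Λ')) →
        -- per old branch: A-fibre domination (K0b)
        (∀ S ∈ admSOfRecord F θ.ν θ.τ9.M (gOfRecord₁₃ F N θ.toStage13Params p) p.K k s.init, ∀ j : ℕ,
          ∃ ŵ : (↥(Set.toFinite (B10Eq42TorusConstraint.bondsIn j ((s.init.Λ (j + 1))ᶜ ∩ s.init.Ω (j + 1)))).toFinset → FluctV N) → ℝ≥0∞, Measurable ŵ ∧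
            (∫⁻ a, ŵ a ∂(Measure.pi fun _ : ↥(Set.toFinite (B10Eq42TorusConstraint.bondsIn j ((s.init.Λ (j + 1))ᶜ ∩ s.init.Ω (j + 1)))).toFinset => (volume : Measure (FluctV N)))) ≠ ⊤ ∧
            ∀ ω, ENNReal.ofReal ((WtOfRecord₁₃H F N θ p s).w j (s.init.Λ (j + 1)) ((s.init.Λ (j + 1))ᶜ ∩ s.init.Ω (j + 1)) (S (j + 1)) ω) ≤
              ŵ (fun b : ↥(Set.toFinite (B10Eq42TorusConstraint.bondsIn j ((s.init.Λ (j + 1))ᶜ ∩ s.init.Ω (j + 1)))).toFinset => (ω j).2 b)) →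
        (slotsTOfRecord F N θ.ν θ.τ9 (EOfRecord₁₃ F N θ.toStage13Params) (wOfRecord₉ F N θ.toStage9Params) θ.ppSel p
            (gOfRecord₁₃ F N θ.toStage13Params p) (k + 1) s = 0 ∨
          ∀ᵐ V' ∂fieldMeasure (F.P p.K) (k + 1) (SU N),
            chiSeqOfRecord F N θ.ν θ.τ9.M (gOfRecord₁₃ F N θ.toStage13Params p) p.K (k + 1) s V' ≠ 0 →
              slotsTOfRecord F N θ.ν θ.τ9 (EOfRecord₁₃ F N θ.toStage13Params) (wOfRecord₉ F N θ.toStage9Params) θ.ppSel p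
                  (gOfRecord₁₃ F N θ.toStage13Params p) (k + 1) s V' =
                sect2Slot F N (FluctV N) p.K (settingOfRecord₁₃ F N θ.toStage13Params p) (θ.rzAt p s) (WtOfRecord₁₃H F N θ p s) s
                  (t₀ s.init) (E₀ s.init) (UbgOfRecord₁₃CoP F N θ.toStage13Params p (k + 1) s) V') :=
  clause_succ_sameWitness_of_hasSect2FormAtZS_of_borelB_of_zhPin_of_solvable θ p hζ0 h hθ hpos hM₁ hle hk (Nat.lt_of_lt_of_le hM₁ hle)
    (fun j hj => hw' j (Nat.le_succ_of_le hj)) (hPC'.of_le (Nat.le_succ k)) hw' hPC' hk1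
    ((Nat.succ_le_of_lt hk).trans (Nat.le_add_left _ _)) hcR h3 hR hε hε3 hε2 hsolv (cover_row_of_partCompat_of_nesting θ p hdiv hPC') t₀ E₀ hform₀ hBt

/-! ## §2  A6: the nesting numeric at K1's witness of record `θ₁₅ᶜᶜᴹᵂ(j; γ)` (`M₂ = 1`, `M = L^j`) -/

section Witness

variable (F : T4Family) (N : ℕ) [NeZero N] (j : ℕ) (γ ε₀ ε₂₉ B₃ B₃' a₀ a₁ : ℝ)

/-- **THE NESTING NUMERIC HOLDS AT K1's WITNESS OF RECORD** `θ₁₅ᶜᶜᴹᵂ(j; γ)` for every `j ≥ 1`: there `M₂ = 1` and `M = L^j` (dag-n21-c, `rfl`), and `L·1 ∣ L^j`.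
[cite: Balaban1988Convergent, (2.1) p.254, (2.17) p.257 (bookkeeping witness); Balaban1989LargeFieldI, (2.1) p.182] -/
theorem nesting_theta13OfThm1CCMW (hj : 1 ≤ j) (K : ℕ) :
    (F.P K).L * (theta13OfThm1CCMW F N j γ ε₀ ε₂₉ B₃ B₃' a₀ a₁).ν.M₂ ∣ (theta13OfThm1CCMW F N j γ ε₀ ε₂₉ B₃ B₃' a₀ a₁).τ9.M := by
  rw [theta13OfThm1CCMW_M₂, theta13OfThm1CCMW_τ9_M, mul_one, T4Family.P_L]
  exact dvd_pow_self F.L (by omega)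

/-- The same at A1's collared witness `θ₁₅ᶜᶜᴹ(j)` (the `γ = ½` member). [cite: Balaban1988Convergent, (2.17) p.257 (bookkeeping witness)] -/
theorem nesting_theta13OfThm1CCM (hj : 1 ≤ j) (K : ℕ) :
    (F.P K).L * (theta13OfThm1CCM F N j ε₀ ε₂₉ B₃ B₃' a₀ a₁).ν.M₂ ∣ (theta13OfThm1CCM F N j ε₀ ε₂₉ B₃ B₃' a₀ a₁).τ9.M := by
  rw [theta13OfThm1CCM_M₂, theta13OfThm1CCM_τ9_M, mul_one, T4Family.P_L]
  exact dvd_pow_self F.L (by omega)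

end Witness

end Summit.QuantumFields.YangMills.Theorems.BalabanUVNodesN11SameWitnessZhPinOfSolvableOfNesting

end
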